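import Summits.QuantumFields.YangMills.Theorems.BalabanUVNodesN07ShearSizeTopBoxDataAxial
import Summits.QuantumFields.YangMills.Theorems.BalabanUVNodesN07ChartLogReality
import Literature.MathematicalPhysics.QuantumFieldTheory.Balaban1983to89.Node00.TorusCoverCubeDomains
import Literature.MathematicalPhysics.QuantumFieldTheory.Balaban1983to89.Node00.DomainsMeet
import HarnessLib

/-!
# DAG node N07 [B11] — road R0′ rows (r1)+(r4) AT THE RECORD with the Landau copy's letter `a` SUPPLIED from the chart: when the Landau copy `U₁` is READ in
# dag-n07-w2's weighted-ball chart `U₁(b) = e^{iηA(b)}` ([15] (152) «U₁ = e^{iηA}»), its (0.4) averages of record satisfy `dist1 M^j(U₁)(c) ≤ 60ℓLR` at EVERY index bond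
# `(j, c)` of the chart's family `D` (`ℓ = (d+2)L`, `R` the ball radius) — dag-n07-w2's local dictionary `coe_emlIterU_expCfg_eq_iter` read through `avOfRecord_apply` — so on a
# box of `T^{(j)}` whose bonds are index bonds of `D` the composed rows of this base's `…N07ShearSizeTopBox(DataAxial)` hold with `a := 60ℓLR`

Cell `pub-ymgap` (HUMAN RULINGS D-0062 ∕ D-0088 ∕ D-0149), width seat `pub-ymgap-dag-n07-w6` (second wave), harness re-seat g0″, 2026-08-28; CLAIM-1 of this generation = the junction named by
the lane owner dag-n07-e g20 (`K0-ROAD-CHAIN-CHECKLIST.md` §4 «Letter `a` (Landau copy's top averages) = n07-w2 `norm_chartLog_le_weightedBall` via `Prop8ChartDefs.chartLog` + UST bridge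
(n07-w6 records display it)»).  `--kind proof --supports stmt-QuantumFields-27364 --as helper` (K1⁹ per dag-lead KEY MAP v2; count-neutral).  THEOREMS ONLY.

THE PRINT.  [15] = [B11] = T. Bałaban, *The variational problem and background fields in renormalization group method for lattice gauge theories*, Commun. Math. Phys. **102** (1985)
277–309 `[Balaban1985Variational]`: p. 301 (152) «there exists a unique gauge transformation u … U₁ = U′^{u⁻¹} = e^{iηA}, … L^jη|A|, … < 9dL²B₁Mε₀ … on 𝔅_k», (156) p. 302 «Q_j(ηA) = B on Λ′_j … B = (1∕i)
log V₁»; [I] = [Balaban1987RG1] (0.4) p. 253 (the guarded exp[mean log] average — the averaging of record `Node00.avOfRecord`, `avOfRecord_apply`).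

WHAT THIS FILE DOES (by-name composition; NOTHING of [B11]∕[15]∕[6]∕[3] analysis asserted).
* §1 ★★ `dist1_iter_avOfRecord_le_of_chart` — THE LETTER `a` AT EVERY INDEX BOND: for a nested family `D` on the torus `F.P K` (`D.k = k`, collar), level weights `IsLevWeight (F.P K) k D w`,
  the weighted ball `w₁(b)‖A(b)‖ < R` with `12800ℓ²LR ≤ 1` and the guard budget `60ℓ²LR < δ_N`, and an `SU(N)` field `U₁` whose matrices ARE the charted bond variables `e^{iηA(b)}`
  (`hUA`, dag-n07-w2's binder verbatim): `dist1 (M^j(U₁)(c)) ≤ 60ℓLR` for every `j`, every `c` with `D.LamBond j c` — `N07ChartLogReality.coe_emlIterU_expCfg_eq_iter` (second conjunct) at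
  the index `⟨(j, c), _⟩`, `avOfRecord F N K = fun _ => blockAvg expMeanLogSU` (rfl).  `dist1_iter_avOfRecord_le_of_chart_box` — the box edition: if every level-`j` bond with both ends in
  the box `castSite '' [lo, hi]` is an index bond of `D` (displayed `hbox`), the bond letter `ha` of this base's rows holds with `a := 60ℓLR`.
* §2 ★★★ `norm_mlog_iter_avOfRecord_centred_sub_le_chart` — this base's composed rows (r1)+(r4) `N07ShearSizeTopBox.norm_mlog_iter_avOfRecord_centred_sub_le` with `a := 60ℓLR` SUPPLIED
  (data letter `v` displayed); ★★★ `norm_mlog_iter_avOfRecord_centred_sub_le_dataAxial_chart` — the `v := (d−1)nδ` edition (`…DataAxial`, module 40's `hdata` displayed) with `a := 60ℓLR`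
  SUPPLIED: only the chart binders, `hbox`, `hdata`∕`v`, the axial gauge `u` and the thresholds remain displayed.
* §3 THE TOP BOX OF A CUBE TOWER IS MADE OF INDEX BONDS: `lamBond_top_of_src_mem_Om` (generic `D`: a top-level bond with source in `Ω_k^{(k)}` is an index bond, `lamBond_top_iff`);
  ★ `lamBond_cubeDomains_top_of_mem_box` — for dag-n07-e's `Node00.cubeDomains P a M ρ k hk` (module 39) every `k`-bond with SOURCE in the covered top box
  `castSite '' [sqLo k, sqHi k]` is an index bond (`castSite = coverAt` letter for letter, `coverAt_mem_cubeDomains_Om`) — `hbox` of §1∕§2 for the window of [15] (144) keyed on the cube tower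
  alone; `lamBond_domainsMeet_top_of_src_mem` ∕ ★ `lamBond_meet_cubeDomains_top_of_mem_box` — the same for dag-n07-e's MEET family `domainsMeet D₁ D₂` of two families of equal height
  (module 44B; the S6 head's per-cube family `D″ = domainsMeet (cubeDomains …) (domainsOfSeq …)`): source in the covered top box AND in `D₂`'s top region ⇒ index bond;
  ★★★ `norm_mlog_iter_avOfRecord_centred_sub_le_chart_cubeTop` — THE PER-DATUM CAPSTONE: §2's letter-free row on the TOP CUBE `[sqLo k, sqHi k]` of the cube tower with the chart keyed
  on the tower itself, `hbox` DISCHARGED (displayed: the tower's collar, chart binders, `hdata`, `u`, extent∕non-wrapping, thresholds).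
* §4 (A6) NON-VACUITY: `chart_ball_zero` ∕ `coe_one_eq_expCfg_zero` — at `A = 0` the ball hypothesis holds for every `R > 0` and `U₁ = 1` IS the charted field (`expCfg_zero`);
  `exists_chart_radius` — a radius meeting both numeric binders exists (`R := δ_N∕(12800ℓ²L)`); `dist1_iter_avOfRecord_le_of_chart_flat` — §1's conclusion at the flat datum for ANY
  collared family, weights and admissible `R` (paired with `dist1 M^j(1)(c) ≤ 0`), so with dag-n07-w2's `N07ChartDOfRecord.chartBinders_inhabited` + `Prop8Chart.collar_of_adm22` the binder
  block of §1 is inhabited on every torus.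

HONEST FRAMING (binding).  Count-neutral helper; by-name composition of LANDED theorems (dag-n07-w2 `…N07ChartLogReality` §2, this base p613291∕p613938∕p615982, node00-def `avOfRecord`, dag-n07-e
module 39 `Node00.cubeDomains`); the chart binders (`hcollar`, `hw`, `hR`, `hguard`, `hA`, `hUA`), `hbox`, the data letter `v` ∕ module 40's `hdata`, the axial gauge `u`, the (1.29) normalisation
and the box's non-wrapping are HYPOTHESES; the Landau copy `u` of [6] Thm 2 is NOT constructed; nothing of [B11]∕[15]∕[6]∕[3] analysis asserted; BRIDGE-92-B stays GAP-STATED until the S6 head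
knits (r0)–(r4); `stub_prop8StepCoP13` ∕ K0⁷ ∕ K1⁹ NOT closed; N07 NOT discharged; the chair's tally of record is the only count; **no summit statement is proved by this seat** — one finite
`T⁴` programme at fixed `ε`, Bałaban AS PRINTED; the route closes the conditional finite-𝕋⁴ rung `BalabanLadder.UV` only; NOT continuum ∕ ℝ⁴ ∕ OS ∕ mass gap ∕ Clay.
No `sorry`, no `def`, no `instance`, no `notation`.
-/

noncomputable section

namespace Summit.QuantumFields.YangMills.BalabanUVNodes.N07ShearSizeTopBoxChartA

open scoped Matrix.Norms.L2Operator
open Literature.MathematicalPhysics.QuantumFieldTheory.Balaban1983to89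
open Literature.MathematicalPhysics.QuantumFieldTheory.Balaban1983to89.Node00
open T4Continuum
open T4AxialGaugeSmallField (castSite axialGauge boxPlaqs)
open B6SectADomainsV1 (Domains)
open B6SectAOperatorsV1 (BondIdx)
open B7Prop1Local (InBox)
open B8Eq131Cubes (sqLo sqHi)
open B14DomainGeom (Pt)
open B16Sect1Backgrounds (toMS)
open GaugeField (gaugeAct)
open ExpMeanLog (expMeanLogSU deltaSU)
open BlockAveraging (blockAvg)
open MatrixLog (mlog)
open Summit.QuantumFields.YangMills.Theorems.Prop8Chart (expCfg expCfg_zero)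
open Summit.QuantumFields.YangMills.Theorems.K0FlatCubeOpsTextP (IsLevWeight)
open Summit.QuantumFields.YangMills.BalabanUVNodes.N07ChartLogReality (coe_emlIterU_expCfg_eq_iter)
open Summit.QuantumFields.YangMills.BalabanUVNodes.N07ShearSizeTopBox (norm_mlog_iter_avOfRecord_centred_sub_le dist1_iter_avOfRecord_one)
open Summit.QuantumFields.YangMills.BalabanUVNodes.N07ShearSizeTopBoxDataAxial (norm_mlog_iter_avOfRecord_centred_sub_le_dataAxial)

variable (F : T4Continuum.T4Family) (N : ℕ) [NeZero N]

/-! ## §1  The letter `a` at every index bond of the chart's family, and on a box of index bonds -/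

section Letter

/-- ★★ **THE LETTER `a` FROM THE CHART, AT EVERY INDEX BOND.**  Torus `F.P K`, a nested family `D` with `D.k = k` and the collar property, level weights `w`
(`IsLevWeight (F.P K) k D w`), the weighted ball `w₁(b)‖A(b)‖ < R` with `12800ℓ²LR ≤ 1` and the guard budget `60ℓ²LR < δ_N` (`ℓ = (d+2)L`), and an `SU(N)` field `U₁` on
`T^{(0)}` whose matrices are the charted bond variables `e^{iηA(b)}`, `η = L^{−k}` (`hUA`).  Then for every level `j` and every index bond `c ∈ Λ_j` of `D`:
`dist1 (M^j(U₁)(c)) ≤ 60ℓLR` for the averaging of record — dag-n07-w2's dictionary `coe_emlIterU_expCfg_eq_iter` (its near-flatness conjunct) at the index `(j, c)`, read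
through `avOfRecord_apply`. [cite: Balaban1985Variational, (152) p.301, (156) p.302; Balaban1987RG1, (0.4) p.253] -/
theorem dist1_iter_avOfRecord_le_of_chart (K k : ℕ) (D : Domains (F.P K)) (hDk : D.k = k)
    (hcollar : ∀ (i : ℕ) (e : PBond (F.P K) (i + 1)), D.LamBond (i + 1) e → ∀ z : Site (F.P K) i, (blockOf z = e.src ∨ blockOf z = e.tgt) → z ∈ D.Om i)
    {w : ℕ → PBond (F.P K) 0 → ℝ} (hw : IsLevWeight (F.P K) k D w) {R : ℝ}
    (hR : 12800 * ((((F.P K).d + 2) * (F.P K).L : ℕ) : ℝ) ^ 2 * ((F.P K).L : ℝ) * R ≤ 1)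
    (hguard : 60 * ((((F.P K).d + 2) * (F.P K).L : ℕ) : ℝ) ^ 2 * ((F.P K).L : ℝ) * R < deltaSU (Fin N))
    {A : PBond (F.P K) 0 → MatA N} (hA : ∀ b, w 1 b * ‖A b‖ < R)
    (U₁ : GaugeField (F.P K) 0 (SU N))
    (hUA : ∀ b, ((U₁ b : SU N) : MatA N) = ((expCfg ((((F.P K).L : ℝ)⁻¹) ^ k) A b : (MatA N)ˣ) : MatA N))
    {j : ℕ} {c : PBond (F.P K) j} (hc : D.LamBond j c) :
    dist1 (Averaging.iter (avOfRecord F N K) j U₁ c) ≤ 60 * ((((F.P K).d + 2) * (F.P K).L : ℕ) : ℝ) * ((F.P K).L : ℝ) * R := by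
  have hjk : j < D.k + 1 := Nat.lt_succ_of_le (D.le_of_lamBond hc)
  have h := (coe_emlIterU_expCfg_eq_iter k D hDk hcollar hw hR hguard hA U₁ hUA ⟨⟨⟨j, hjk⟩, c⟩, hc⟩).2
  exact h

/-- **THE LETTER `a` ON A BOX OF INDEX BONDS** — the bond hypothesis `ha` of this base's rows (r1)+(r4) SUPPLIED: in the setting of `dist1_iter_avOfRecord_le_of_chart`, if every
level-`j` bond with both ends in the box `castSite '' [lo, hi]` of `T^{(j)}` is an index bond of `D` (`hbox`), then `dist1 (M^j(U₁)(c)) ≤ 60ℓLR` on every such bond.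
[cite: Balaban1985Variational, (144) p.300, (152) p.301] -/
theorem dist1_iter_avOfRecord_le_of_chart_box (K k : ℕ) (D : Domains (F.P K)) (hDk : D.k = k)
    (hcollar : ∀ (i : ℕ) (e : PBond (F.P K) (i + 1)), D.LamBond (i + 1) e → ∀ z : Site (F.P K) i, (blockOf z = e.src ∨ blockOf z = e.tgt) → z ∈ D.Om i)
    {w : ℕ → PBond (F.P K) 0 → ℝ} (hw : IsLevWeight (F.P K) k D w) {R : ℝ}
    (hR : 12800 * ((((F.P K).d + 2) * (F.P K).L : ℕ) : ℝ) ^ 2 * ((F.P K).L : ℝ) * R ≤ 1)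
    (hguard : 60 * ((((F.P K).d + 2) * (F.P K).L : ℕ) : ℝ) ^ 2 * ((F.P K).L : ℝ) * R < deltaSU (Fin N))
    {A : PBond (F.P K) 0 → MatA N} (hA : ∀ b, w 1 b * ‖A b‖ < R)
    (U₁ : GaugeField (F.P K) 0 (SU N))
    (hUA : ∀ b, ((U₁ b : SU N) : MatA N) = ((expCfg ((((F.P K).L : ℝ)⁻¹) ^ k) A b : (MatA N)ˣ) : MatA N))
    {j : ℕ} {lo hi : Fin (F.P K).d → ℤ}
    (hbox : ∀ c : PBond (F.P K) j, c.src ∈ (castSite '' Set.Icc lo hi : Set (Site (F.P K) j)) → c.tgt ∈ (castSite '' Set.Icc lo hi : Set (Site (F.P K) j)) → D.LamBond j c) :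
    ∀ c : PBond (F.P K) j, c.src ∈ (castSite '' Set.Icc lo hi : Set (Site (F.P K) j)) → c.tgt ∈ (castSite '' Set.Icc lo hi : Set (Site (F.P K) j)) →
      dist1 (Averaging.iter (avOfRecord F N K) j U₁ c) ≤ 60 * ((((F.P K).d + 2) * (F.P K).L : ℕ) : ℝ) * ((F.P K).L : ℝ) * R :=
  fun c hs ht => dist1_iter_avOfRecord_le_of_chart F N K k D hDk hcollar hw hR hguard hA U₁ hUA (hbox c hs ht)

omit [NeZero N] in
/-- The chart's letter is non-negative: `0 ≤ 60ℓLR` once the ball is inhabited at some bond (`w₁(b)‖A(b)‖ ≥ 0`). [cite: Balaban1985Variational, (152) p.301 (bookkeeping)] -/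
theorem chart_letter_nonneg (K k : ℕ) (D : Domains (F.P K)) {w : ℕ → PBond (F.P K) 0 → ℝ} (hw : IsLevWeight (F.P K) k D w) {R : ℝ}
    {A : PBond (F.P K) 0 → MatA N} (hA : ∀ b, w 1 b * ‖A b‖ < R) (b₀ : PBond (F.P K) 0) :
    0 ≤ 60 * ((((F.P K).d + 2) * (F.P K).L : ℕ) : ℝ) * ((F.P K).L : ℝ) * R := by
  have hL0 : (0 : ℝ) < (F.P K).L := by exact_mod_cast (F.P K).L_pos
  have hR0 : 0 ≤ R := by
    have h := hA b₀
    have hw0 : 0 ≤ w 1 b₀ * ‖A b₀‖ := by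
      rw [hw 1, pow_one]; exact mul_nonneg (by positivity) (norm_nonneg _)
    linarith
  positivity

end Letter

/-! ## §2  Rows (r1)+(r4) at the record with `a := 60ℓLR` supplied -/

section Rows

/-- ★★★ **ROWS (r1)+(r4) AT THE RECORD WITH THE LANDAU COPY'S LETTER SUPPLIED FROM THE CHART** (`v` displayed).  In the setting of this base's
`N07ShearSizeTopBox.norm_mlog_iter_avOfRecord_centred_sub_le` (averaging of record, torus `K`, level `j ≤ m + K`, box `[lo, hi]` of `T^{(j)}` with corner `y₀ = castSite lo`,
`D♮ := Σ_κ(hi_κ − lo_κ)`, data letter `dist1 M^j(U₁^u)(c) ≤ v ≤ 1∕40` on the box bonds), if the Landau copy `U₁` is READ in dag-n07-w2's weighted-ball chart on a family `D` whose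
level-`j` index bonds contain the box bonds (`hbox`), then with `a := 60ℓLR` and `σ♮ := D♮·(v + a) ≤ 1∕80`, on every box bond `c`:
`‖log M^j(U₁)(c) − (log V♮(c) + (log ĝ(c₋)⁻¹ − log ĝ(c₊)⁻¹))‖ ≤ 8σ♮² + 20σ♮v` — the letter `a` no longer displayed.
[cite: Balaban1985Variational, (152)–(156) pp.301–302, (164) p.303; Balaban1985Averaging, (85)–(88) p.31] -/
theorem norm_mlog_iter_avOfRecord_centred_sub_le_chart (K k : ℕ) (D : Domains (F.P K)) (hDk : D.k = k)
    (hcollar : ∀ (i : ℕ) (e : PBond (F.P K) (i + 1)), D.LamBond (i + 1) e → ∀ z : Site (F.P K) i, (blockOf z = e.src ∨ blockOf z = e.tgt) → z ∈ D.Om i)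
    {w : ℕ → PBond (F.P K) 0 → ℝ} (hw : IsLevWeight (F.P K) k D w) {R : ℝ}
    (hR : 12800 * ((((F.P K).d + 2) * (F.P K).L : ℕ) : ℝ) ^ 2 * ((F.P K).L : ℝ) * R ≤ 1)
    (hguard : 60 * ((((F.P K).d + 2) * (F.P K).L : ℕ) : ℝ) ^ 2 * ((F.P K).L : ℝ) * R < deltaSU (Fin N))
    {A : PBond (F.P K) 0 → MatA N} (hA : ∀ b, w 1 b * ‖A b‖ < R)
    (u : GaugeTransf (F.P K) 0 (SU N)) (U₁ : GaugeField (F.P K) 0 (SU N))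
    (hUA : ∀ b, ((U₁ b : SU N) : MatA N) = ((expCfg ((((F.P K).L : ℝ)⁻¹) ^ k) A b : (MatA N)ˣ) : MatA N))
    {j : ℕ} (hj : j ≤ (F.P K).m + (F.P K).K) {lo hi : Fin (F.P K).d → ℤ}
    (hbox : ∀ c : PBond (F.P K) j, c.src ∈ (castSite '' Set.Icc lo hi : Set (Site (F.P K) j)) → c.tgt ∈ (castSite '' Set.Icc lo hi : Set (Site (F.P K) j)) → D.LamBond j c)
    {v : ℝ} (hv0 : 0 ≤ v)
    (hv : ∀ c : PBond (F.P K) j, c.src ∈ (castSite '' Set.Icc lo hi : Set (Site (F.P K) j)) → c.tgt ∈ (castSite '' Set.Icc lo hi : Set (Site (F.P K) j)) →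
      dist1 (Averaging.iter (avOfRecord F N K) j (gaugeAct u U₁) c) ≤ v)
    (hσ : ((∑ κ, (hi κ - lo κ).toNat : ℕ) : ℝ) * (v + 60 * ((((F.P K).d + 2) * (F.P K).L : ℕ) : ℝ) * ((F.P K).L : ℝ) * R) ≤ 1 / 80) (hv40 : v ≤ 1 / 40)
    {c : PBond (F.P K) j} (hs : c.src ∈ (castSite '' Set.Icc lo hi : Set (Site (F.P K) j))) (ht : c.tgt ∈ (castSite '' Set.Icc lo hi : Set (Site (F.P K) j))) :
    ‖mlog ((Averaging.iter (avOfRecord F N K) j U₁ c : SU N) : MatA N) -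
        (mlog ((((toMS u j (castSite lo))⁻¹ * Averaging.iter (avOfRecord F N K) j (gaugeAct u U₁) c * toMS u j (castSite lo) : SU N)) : MatA N) +
          (mlog (((((toMS u j (castSite lo))⁻¹ * toMS u j c.src)⁻¹ : SU N)) : MatA N) -
            mlog (((((toMS u j (castSite lo))⁻¹ * toMS u j c.tgt)⁻¹ : SU N)) : MatA N)))‖ ≤
      8 * (((∑ κ, (hi κ - lo κ).toNat : ℕ) : ℝ) * (v + 60 * ((((F.P K).d + 2) * (F.P K).L : ℕ) : ℝ) * ((F.P K).L : ℝ) * R)) ^ 2 +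
        20 * (((∑ κ, (hi κ - lo κ).toNat : ℕ) : ℝ) * (v + 60 * ((((F.P K).d + 2) * (F.P K).L : ℕ) : ℝ) * ((F.P K).L : ℝ) * R)) * v :=
  norm_mlog_iter_avOfRecord_centred_sub_le F N K u U₁ hj hv0 (chart_letter_nonneg F N K k D hw hA ⟨fun _ => 0, c.dir⟩) hv
    (dist1_iter_avOfRecord_le_of_chart_box F N K k D hDk hcollar hw hR hguard hA U₁ hUA hbox) hσ hv40 hs ht

/-- ★★★ **ROWS (r1)+(r4) AT THE RECORD, BOTH BOND LETTERS SUPPLIED: `v := (d−1)nδ` (module 40's re-gauged datum, `hdata` displayed) AND `a := 60ℓLR` (the chart).**  In the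
setting of this base's `N07ShearSizeTopBoxDataAxial.norm_mlog_iter_avOfRecord_centred_sub_le_dataAxial` (box `hi ≤ lo + n`, non-wrapping `n + 1 < N_j`, the level-`j` data of the
axial representative on the box IS `V^h`, `h = axialGauge V lo hi`, for a `V` with `δ`-small box plaquettes) and of §1 (the Landau copy READ in the weighted-ball chart on a family
`D` with `hbox`): with `σ♮ := D♮·((d−1)nδ + 60ℓLR) ≤ 1∕80` and `(d−1)nδ ≤ 1∕40`, on every box bond `c`,
`‖log M^j(U₁)(c) − (log V♮(c) + (log ĝ(c₋)⁻¹ − log ĝ(c₊)⁻¹))‖ ≤ 8σ♮² + 20σ♮·(d−1)nδ` — NO bond letter displayed.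
[cite: Balaban1985Variational, (147) p.301, (151)–(156) pp.301–302, (160) p.303] -/
theorem norm_mlog_iter_avOfRecord_centred_sub_le_dataAxial_chart (K k : ℕ) (D : Domains (F.P K)) (hDk : D.k = k)
    (hcollar : ∀ (i : ℕ) (e : PBond (F.P K) (i + 1)), D.LamBond (i + 1) e → ∀ z : Site (F.P K) i, (blockOf z = e.src ∨ blockOf z = e.tgt) → z ∈ D.Om i)
    {w : ℕ → PBond (F.P K) 0 → ℝ} (hw : IsLevWeight (F.P K) k D w) {R : ℝ}
    (hR : 12800 * ((((F.P K).d + 2) * (F.P K).L : ℕ) : ℝ) ^ 2 * ((F.P K).L : ℝ) * R ≤ 1)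
    (hguard : 60 * ((((F.P K).d + 2) * (F.P K).L : ℕ) : ℝ) ^ 2 * ((F.P K).L : ℝ) * R < deltaSU (Fin N))
    {A : PBond (F.P K) 0 → MatA N} (hA : ∀ b, w 1 b * ‖A b‖ < R)
    (u : GaugeTransf (F.P K) 0 (SU N)) (U₁ : GaugeField (F.P K) 0 (SU N))
    (hUA : ∀ b, ((U₁ b : SU N) : MatA N) = ((expCfg ((((F.P K).L : ℝ)⁻¹) ^ k) A b : (MatA N)ˣ) : MatA N))
    {j : ℕ} (hj : j ≤ (F.P K).m + (F.P K).K) {lo hi : Fin (F.P K).d → ℤ} {n : ℕ} (hn : ∀ κ, hi κ ≤ lo κ + n) (hnN : n + 1 < (F.P K).sitesPerDir j)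
    (hbox : ∀ c : PBond (F.P K) j, c.src ∈ (castSite '' Set.Icc lo hi : Set (Site (F.P K) j)) → c.tgt ∈ (castSite '' Set.Icc lo hi : Set (Site (F.P K) j)) → D.LamBond j c)
    (V : GaugeField (F.P K) j (SU N)) {δ : ℝ} {S₀ : Set (Plaq (F.P K) j)} (hS₀ : boxPlaqs lo hi ⊆ S₀) (hV : PlaqSmallOn S₀ δ V) (hδ : 0 ≤ δ)
    (hdata : ∀ c : PBond (F.P K) j, c.src ∈ (castSite '' Set.Icc lo hi : Set (Site (F.P K) j)) → c.tgt ∈ (castSite '' Set.Icc lo hi : Set (Site (F.P K) j)) →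
      Averaging.iter (avOfRecord F N K) j (gaugeAct u U₁) c = gaugeAct (axialGauge V lo hi) V c)
    (hσ : ((∑ κ, (hi κ - lo κ).toNat : ℕ) : ℝ) * ((((F.P K).d - 1 : ℕ) : ℝ) * n * δ + 60 * ((((F.P K).d + 2) * (F.P K).L : ℕ) : ℝ) * ((F.P K).L : ℝ) * R) ≤ 1 / 80)
    (hv40 : (((F.P K).d - 1 : ℕ) : ℝ) * n * δ ≤ 1 / 40)
    {c : PBond (F.P K) j} (hs : c.src ∈ (castSite '' Set.Icc lo hi : Set (Site (F.P K) j))) (ht : c.tgt ∈ (castSite '' Set.Icc lo hi : Set (Site (F.P K) j))) :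
    ‖mlog ((Averaging.iter (avOfRecord F N K) j U₁ c : SU N) : MatA N) -
        (mlog ((((toMS u j (castSite lo))⁻¹ * Averaging.iter (avOfRecord F N K) j (gaugeAct u U₁) c * toMS u j (castSite lo) : SU N)) : MatA N) +
          (mlog (((((toMS u j (castSite lo))⁻¹ * toMS u j c.src)⁻¹ : SU N)) : MatA N) -
            mlog (((((toMS u j (castSite lo))⁻¹ * toMS u j c.tgt)⁻¹ : SU N)) : MatA N)))‖ ≤
      8 * (((∑ κ, (hi κ - lo κ).toNat : ℕ) : ℝ) * ((((F.P K).d - 1 : ℕ) : ℝ) * n * δ + 60 * ((((F.P K).d + 2) * (F.P K).L : ℕ) : ℝ) * ((F.P K).L : ℝ) * R)) ^ 2 +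
        20 * (((∑ κ, (hi κ - lo κ).toNat : ℕ) : ℝ) * ((((F.P K).d - 1 : ℕ) : ℝ) * n * δ + 60 * ((((F.P K).d + 2) * (F.P K).L : ℕ) : ℝ) * ((F.P K).L : ℝ) * R)) *
          ((((F.P K).d - 1 : ℕ) : ℝ) * n * δ) :=
  norm_mlog_iter_avOfRecord_centred_sub_le_dataAxial F N K u U₁ hj hn hnN V hS₀ hV hδ hdata (chart_letter_nonneg F N K k D hw hA ⟨fun _ => 0, c.dir⟩)
    (dist1_iter_avOfRecord_le_of_chart_box F N K k D hDk hcollar hw hR hguard hA U₁ hUA hbox) hσ hv40 hs ht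

end Rows

/-! ## §3  The top box of a cube tower is made of index bonds -/

section TopBox

variable {P : Params}

/-- A top-level bond whose SOURCE lies in `Ω_k^{(k)}` is an index bond of the family (`Λ_k = st_k(Ω_k^{(k)})`, `lamBond_top_iff`); stated at a level `j` with `j = D.k` so that
consumers need not transport bonds along the equation. [cite: Balaban1984PropagatorsII, (2.3) p.224] -/
theorem lamBond_top_of_src_mem_Om (D : Domains P) {j : ℕ} (hj : D.k = j) {c : PBond P j} (hc : c.src ∈ D.Om j) : D.LamBond j c := by
  subst hj
  exact (D.lamBond_top_iff c).2 (Or.inl hc)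

/-- ★ **THE TOP BOX OF dag-n07-e's CUBE TOWER IS MADE OF INDEX BONDS**: for `D := Node00.cubeDomains P a M ρ k hk` ([6] (1.131) ∕ [15] (144), module 39) and `1 ≤ k`, every `k`-bond whose
source lies in the covered top box `castSite '' [sqLo k, sqHi k]` (= `π_k '' □_k^{(k)} = Ω_k^{(k)}`; `castSite` and `coverAt P k` agree letter for letter) is an index bond of `D` — the
`hbox` hypothesis of §1∕§2 for the window keyed on the cube tower alone (the target condition is not even needed). [cite: Balaban1985RegularSpaces, (1.131) p.99; Balaban1985Variational, (144) p.300;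
Balaban1984PropagatorsII, (2.3) p.224] -/
theorem lamBond_cubeDomains_top_of_mem_box {a : Pt P.d} {M ρ k : ℕ} {hk : k ≤ P.m + P.K} (hk1 : 1 ≤ k) {c : PBond P k}
    (hs : c.src ∈ (castSite '' Set.Icc (sqLo P.L a ρ k k) (sqHi P.L a M ρ k k) : Set (Site P k))) :
    (cubeDomains P a M ρ k hk).LamBond k c := by
  refine lamBond_top_of_src_mem_Om (cubeDomains P a M ρ k hk) rfl ?_
  obtain ⟨s, hsI, hse⟩ := hs
  have hin : InBox (sqLo P.L a ρ k k) (sqHi P.L a M ρ k k) s := fun i => ⟨hsI.1 i, hsI.2 i⟩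
  rw [← hse]
  exact coverAt_mem_cubeDomains_Om hk1 le_rfl hin

/-- The same with BOTH ends displayed, in the shape of the `hbox` binder of §1∕§2 (the target condition is discarded). [cite: Balaban1985Variational, (144) p.300 (bookkeeping)] -/
theorem hbox_cubeDomains_top {a : Pt P.d} {M ρ k : ℕ} {hk : k ≤ P.m + P.K} (hk1 : 1 ≤ k) :
    ∀ c : PBond P k, c.src ∈ (castSite '' Set.Icc (sqLo P.L a ρ k k) (sqHi P.L a M ρ k k) : Set (Site P k)) →
      c.tgt ∈ (castSite '' Set.Icc (sqLo P.L a ρ k k) (sqHi P.L a M ρ k k) : Set (Site P k)) → (cubeDomains P a M ρ k hk).LamBond k c :=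
  fun _ hs _ => lamBond_cubeDomains_top_of_mem_box hk1 hs

/-- **THE MEET FAMILY'S TOP BONDS** ([15] (150) «more restrictive functional conditions», dag-n07-e's `Node00.domainsMeet`, module 44B): for two nested families of the SAME height `j`
a level-`j` bond whose source lies in BOTH top regions is an index bond of `domainsMeet D₁ D₂` — the `hbox` one-liner for the S6 head's per-cube family
`D″ = domainsMeet (cubeDomains …) (domainsOfSeq …)` once the window's sites are placed in both top regions (cube side: `lamBond_cubeDomains_top_of_mem_box`'s membership; record side:
module 44C's `inOm_domainsOfSeq_iff`). [cite: Balaban1985Variational, (150) p.301; Balaban1984PropagatorsII, (2.3) p.224] -/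
theorem lamBond_domainsMeet_top_of_src_mem (D₁ D₂ : Domains P) {j : ℕ} (h₁ : D₁.k = j) (h₂ : D₂.k = j) {c : PBond P j}
    (hc₁ : c.src ∈ D₁.Om j) (hc₂ : c.src ∈ D₂.Om j) : (domainsMeet D₁ D₂).LamBond j c :=
  lamBond_top_of_src_mem_Om (domainsMeet D₁ D₂) (by rw [domainsMeet_k, h₁, h₂, min_self]) ((mem_domainsMeet_Om D₁ D₂ j c.src).2 ⟨hc₁, hc₂⟩)

/-- ★ **`hbox` FOR THE MEET OF THE CUBE TOWER WITH ANY FAMILY OF THE SAME HEIGHT**: for `D₂` with `D₂.k = k` (e.g. module 44C's `domainsOfSeq Ω k hk`), every `k`-bond whose source lies in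
the cube tower's covered top box AND in `D₂`'s top region is an index bond of `domainsMeet (cubeDomains P a M ρ k hk) D₂`. [cite: Balaban1985Variational, (144) p.300, (150) p.301] -/
theorem lamBond_meet_cubeDomains_top_of_mem_box {a : Pt P.d} {M ρ k : ℕ} {hk : k ≤ P.m + P.K} (hk1 : 1 ≤ k) (D₂ : Domains P) (h₂ : D₂.k = k) {c : PBond P k}
    (hs : c.src ∈ (castSite '' Set.Icc (sqLo P.L a ρ k k) (sqHi P.L a M ρ k k) : Set (Site P k))) (hs₂ : c.src ∈ D₂.Om k) :
    (domainsMeet (cubeDomains P a M ρ k hk) D₂).LamBond k c := by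
  refine lamBond_domainsMeet_top_of_src_mem _ D₂ rfl h₂ ?_ hs₂
  obtain ⟨s, hsI, hse⟩ := hs
  have hin : InBox (sqLo P.L a ρ k k) (sqHi P.L a M ρ k k) s := fun i => ⟨hsI.1 i, hsI.2 i⟩
  rw [← hse]
  exact coverAt_mem_cubeDomains_Om hk1 le_rfl hin

/-- ★★★ **THE PER-DATUM EDITION ON THE CUBE TOWER — rows (r1)+(r4) at the record on the TOP CUBE `[sqLo k, sqHi k]` of dag-n07-e's `cubeDomains (F.P K) a M ρ k hk` with BOTH bond letters
supplied** (`v := (d−1)nδ` from module 40's re-gauged datum, `a := 60ℓLR` from the chart KEYED ON THE CUBE TOWER ITSELF) — `hbox` DISCHARGED by `hbox_cubeDomains_top`; displayed: the tower's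
collar (`hcollar`; for a print datum it is `Prop8Chart.collar_of_adm22 (adm22_cubeDomains_of_isPrint …)`, module 39b), the chart binders, `hdata`, the axial gauge `u`, the top cube's extent
`sqHi ≤ sqLo + n` and non-wrapping `n + 1 < N_k`, and the two thresholds. [cite: Balaban1985Variational, (144) p.300, (147) p.301, (151)–(156) pp.301–302, (160) p.303; Balaban1985RegularSpaces, (1.131) p.99] -/
theorem norm_mlog_iter_avOfRecord_centred_sub_le_chart_cubeTop (K : ℕ) {a : Pt (F.P K).d} {M ρ k : ℕ} {hk : k ≤ (F.P K).m + (F.P K).K} (hk1 : 1 ≤ k)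
    (hcollar : ∀ (i : ℕ) (e : PBond (F.P K) (i + 1)), (cubeDomains (F.P K) a M ρ k hk).LamBond (i + 1) e →
      ∀ z : Site (F.P K) i, (blockOf z = e.src ∨ blockOf z = e.tgt) → z ∈ (cubeDomains (F.P K) a M ρ k hk).Om i)
    {w : ℕ → PBond (F.P K) 0 → ℝ} (hw : IsLevWeight (F.P K) k (cubeDomains (F.P K) a M ρ k hk) w) {R : ℝ}
    (hR : 12800 * ((((F.P K).d + 2) * (F.P K).L : ℕ) : ℝ) ^ 2 * ((F.P K).L : ℝ) * R ≤ 1)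
    (hguard : 60 * ((((F.P K).d + 2) * (F.P K).L : ℕ) : ℝ) ^ 2 * ((F.P K).L : ℝ) * R < deltaSU (Fin N))
    {A : PBond (F.P K) 0 → MatA N} (hA : ∀ b, w 1 b * ‖A b‖ < R)
    (u : GaugeTransf (F.P K) 0 (SU N)) (U₁ : GaugeField (F.P K) 0 (SU N))
    (hUA : ∀ b, ((U₁ b : SU N) : MatA N) = ((expCfg ((((F.P K).L : ℝ)⁻¹) ^ k) A b : (MatA N)ˣ) : MatA N))
    {n : ℕ} (hn : ∀ κ, sqHi (F.P K).L a M ρ k k κ ≤ sqLo (F.P K).L a ρ k k κ + n) (hnN : n + 1 < (F.P K).sitesPerDir k)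
    (V : GaugeField (F.P K) k (SU N)) {δ : ℝ} {S₀ : Set (Plaq (F.P K) k)} (hS₀ : boxPlaqs (sqLo (F.P K).L a ρ k k) (sqHi (F.P K).L a M ρ k k) ⊆ S₀)
    (hV : PlaqSmallOn S₀ δ V) (hδ : 0 ≤ δ)
    (hdata : ∀ c : PBond (F.P K) k, c.src ∈ (castSite '' Set.Icc (sqLo (F.P K).L a ρ k k) (sqHi (F.P K).L a M ρ k k) : Set (Site (F.P K) k)) →
      c.tgt ∈ (castSite '' Set.Icc (sqLo (F.P K).L a ρ k k) (sqHi (F.P K).L a M ρ k k) : Set (Site (F.P K) k)) →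
      Averaging.iter (avOfRecord F N K) k (gaugeAct u U₁) c = gaugeAct (axialGauge V (sqLo (F.P K).L a ρ k k) (sqHi (F.P K).L a M ρ k k)) V c)
    (hσ : ((∑ κ, (sqHi (F.P K).L a M ρ k k κ - sqLo (F.P K).L a ρ k k κ).toNat : ℕ) : ℝ) *
        ((((F.P K).d - 1 : ℕ) : ℝ) * n * δ + 60 * ((((F.P K).d + 2) * (F.P K).L : ℕ) : ℝ) * ((F.P K).L : ℝ) * R) ≤ 1 / 80)
    (hv40 : (((F.P K).d - 1 : ℕ) : ℝ) * n * δ ≤ 1 / 40)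
    {c : PBond (F.P K) k} (hs : c.src ∈ (castSite '' Set.Icc (sqLo (F.P K).L a ρ k k) (sqHi (F.P K).L a M ρ k k) : Set (Site (F.P K) k)))
    (ht : c.tgt ∈ (castSite '' Set.Icc (sqLo (F.P K).L a ρ k k) (sqHi (F.P K).L a M ρ k k) : Set (Site (F.P K) k))) :
    ‖mlog ((Averaging.iter (avOfRecord F N K) k U₁ c : SU N) : MatA N) -
        (mlog ((((toMS u k (castSite (sqLo (F.P K).L a ρ k k)))⁻¹ * Averaging.iter (avOfRecord F N K) k (gaugeAct u U₁) c *
              toMS u k (castSite (sqLo (F.P K).L a ρ k k)) : SU N)) : MatA N) +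
          (mlog (((((toMS u k (castSite (sqLo (F.P K).L a ρ k k)))⁻¹ * toMS u k c.src)⁻¹ : SU N)) : MatA N) -
            mlog (((((toMS u k (castSite (sqLo (F.P K).L a ρ k k)))⁻¹ * toMS u k c.tgt)⁻¹ : SU N)) : MatA N)))‖ ≤
      8 * (((∑ κ, (sqHi (F.P K).L a M ρ k k κ - sqLo (F.P K).L a ρ k k κ).toNat : ℕ) : ℝ) *
            ((((F.P K).d - 1 : ℕ) : ℝ) * n * δ + 60 * ((((F.P K).d + 2) * (F.P K).L : ℕ) : ℝ) * ((F.P K).L : ℝ) * R)) ^ 2 +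
        20 * (((∑ κ, (sqHi (F.P K).L a M ρ k k κ - sqLo (F.P K).L a ρ k k κ).toNat : ℕ) : ℝ) *
            ((((F.P K).d - 1 : ℕ) : ℝ) * n * δ + 60 * ((((F.P K).d + 2) * (F.P K).L : ℕ) : ℝ) * ((F.P K).L : ℝ) * R)) *
          ((((F.P K).d - 1 : ℕ) : ℝ) * n * δ) :=
  norm_mlog_iter_avOfRecord_centred_sub_le_dataAxial_chart F N K k (cubeDomains (F.P K) a M ρ k hk) rfl hcollar hw hR hguard hA u U₁ hUA hk hn hnN
    (hbox_cubeDomains_top hk1) V hS₀ hV hδ hdata hσ hv40 hs ht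

end TopBox

/-! ## §4  (A6) Non-vacuity: the chart binders of §1 are inhabited at the flat datum -/

section NonVacuity

omit [NeZero N] in
/-- At `A = 0` the weighted-ball hypothesis holds for every radius `R > 0` and every weight. [cite: Balaban1985Variational, (152) p.301 (bookkeeping)] -/
theorem chart_ball_zero (K : ℕ) (w : ℕ → PBond (F.P K) 0 → ℝ) {R : ℝ} (hR0 : 0 < R) :
    ∀ b : PBond (F.P K) 0, w 1 b * ‖(0 : PBond (F.P K) 0 → MatA N) b‖ < R := fun b => by
  simpa using hR0

/-- The unit configuration IS the field charted by `A = 0`: `1 = e^{iη·0}` bondwise (`Prop8Chart.expCfg_zero`). [cite: Balaban1985Variational, (152) p.301 (bookkeeping)] -/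
theorem coe_one_eq_expCfg_zero (K : ℕ) (η : ℝ) :
    ∀ b : PBond (F.P K) 0, (((1 : GaugeField (F.P K) 0 (SU N)) b : SU N) : MatA N) = ((expCfg η (0 : PBond (F.P K) 0 → MatA N) b : (MatA N)ˣ) : MatA N) := fun b => by
  rw [expCfg_zero]
  rfl

/-- A radius meeting BOTH numeric binders of §1 exists on every torus: `R := δ_N ∕ (12800ℓ²L)` gives `12800ℓ²LR = δ_N ≤ 1` and `60ℓ²LR = 60δ_N∕12800 < δ_N` (`deltaSU_pos`, `deltaSU ≤ 1∕3`).
[cite: Balaban1985Variational, (152) p.301; Balaban1985Averaging, Prop. 4 p.38 (bookkeeping)] -/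
theorem exists_chart_radius (K : ℕ) :
    ∃ R : ℝ, 0 < R ∧ 12800 * ((((F.P K).d + 2) * (F.P K).L : ℕ) : ℝ) ^ 2 * ((F.P K).L : ℝ) * R ≤ 1 ∧
      60 * ((((F.P K).d + 2) * (F.P K).L : ℕ) : ℝ) ^ 2 * ((F.P K).L : ℝ) * R < deltaSU (Fin N) := by
  set ℓ : ℝ := ((((F.P K).d + 2) * (F.P K).L : ℕ) : ℝ) with hℓ
  have hL1 : (1 : ℝ) ≤ (F.P K).L := by exact_mod_cast (F.P K).L_pos
  have hL0 : (0 : ℝ) < (F.P K).L := by linarith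
  have hℓ1 : (1 : ℝ) ≤ ℓ := by
    rw [hℓ]; exact_mod_cast Nat.one_le_iff_ne_zero.mpr (Nat.mul_ne_zero (by omega) (by have := (F.P K).hL.2; omega))
  have hℓ0 : (0 : ℝ) < ℓ := by linarith
  have hδ0 : 0 < deltaSU (Fin N) := ExpMeanLog.deltaSU_pos
  have hδ1 : deltaSU (Fin N) ≤ 1 := (min_le_left _ _).trans (by norm_num)
  have hc0 : (0 : ℝ) < 12800 * ℓ ^ 2 * (F.P K).L := by positivity
  refine ⟨deltaSU (Fin N) / (12800 * ℓ ^ 2 * (F.P K).L), div_pos hδ0 hc0, ?_, ?_⟩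
  · rw [mul_div_assoc', div_le_one hc0]
    calc 12800 * ℓ ^ 2 * ((F.P K).L : ℝ) * deltaSU (Fin N) ≤ 12800 * ℓ ^ 2 * ((F.P K).L : ℝ) * 1 := by gcongr
      _ = 12800 * ℓ ^ 2 * (F.P K).L := mul_one _
  · rw [mul_div_assoc', div_lt_iff₀ hc0]
    nlinarith

/-- **A6: §1's binder block is inhabited at the flat datum, and its conclusion is consistent there.**  For ANY family `D` with a collar, ANY weights and ANY admissible radius `R > 0`
(such `R` exist, `exists_chart_radius`; such `D`, `w` exist on every torus, dag-n07-w2's `N07ChartDOfRecord.chartBinders_inhabited` + `Prop8Chart.collar_of_adm22`), the unit configuration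
`U₁ = 1` is charted by `A = 0` (`coe_one_eq_expCfg_zero`, `chart_ball_zero`) and §1 yields `dist1 M^j(1)(c) ≤ 60ℓLR` at every index bond — where indeed `dist1 M^j(1)(c) = 0`
(`N07ShearSizeTopBox.dist1_iter_avOfRecord_one`). [cite: Balaban1985Variational, (152) p.301 (bookkeeping)] -/
theorem dist1_iter_avOfRecord_le_of_chart_flat (K k : ℕ) (D : Domains (F.P K)) (hDk : D.k = k)
    (hcollar : ∀ (i : ℕ) (e : PBond (F.P K) (i + 1)), D.LamBond (i + 1) e → ∀ z : Site (F.P K) i, (blockOf z = e.src ∨ blockOf z = e.tgt) → z ∈ D.Om i)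
    {w : ℕ → PBond (F.P K) 0 → ℝ} (hw : IsLevWeight (F.P K) k D w) {R : ℝ} (hR0 : 0 < R)
    (hR : 12800 * ((((F.P K).d + 2) * (F.P K).L : ℕ) : ℝ) ^ 2 * ((F.P K).L : ℝ) * R ≤ 1)
    (hguard : 60 * ((((F.P K).d + 2) * (F.P K).L : ℕ) : ℝ) ^ 2 * ((F.P K).L : ℝ) * R < deltaSU (Fin N))
    {j : ℕ} {c : PBond (F.P K) j} (hc : D.LamBond j c) :
    dist1 (Averaging.iter (avOfRecord F N K) j (1 : GaugeField (F.P K) 0 (SU N)) c) ≤ 60 * ((((F.P K).d + 2) * (F.P K).L : ℕ) : ℝ) * ((F.P K).L : ℝ) * R ∧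
      dist1 (Averaging.iter (avOfRecord F N K) j (1 : GaugeField (F.P K) 0 (SU N)) c) ≤ 0 :=
  ⟨dist1_iter_avOfRecord_le_of_chart F N K k D hDk hcollar hw hR hguard (chart_ball_zero F N K w hR0) 1
      (coe_one_eq_expCfg_zero F N K _) hc,
    dist1_iter_avOfRecord_one F N K j c⟩

end NonVacuity

end Summit.QuantumFields.YangMills.BalabanUVNodes.N07ShearSizeTopBoxChartA
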